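import Summits.ValiantsHypothesis.ValiantsHypothesis.Theorems.DepthWindowRiffleBridge

/-!
# `R_riffle(I₂ ⊗ I₂) ≤ 3` over every commutative ring — a negative datum for the riffle bridge

Negative-side helper for the crux `HomImmHardTwoOne` (item stmt-ValiantsHypothesis-30635) of route
`DepthWindow`, concerning the conjectural input `RiffleIdentityBound` of
`Theorems/DepthWindowRiffleBridge.lean` (decomp-valiant workshop, critic seat, 2026-08-30).

With `IsRiffleBasic` as typed there — `t(a,b) = g(b₁,…,b_k) · ∏ᵢ Aᵢ(aᵢ ; b₁,…,b_{i-1})`, which is the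
reading of Rossman's Definition 3.1 forced by the parameter count `q^{n^k} · ∏ᵢ q^{n^i}` of his
Lemma 3.3(2) — the `2`-fold identity tensor `I₂ ⊗ I₂ = idPow R 2 2` is a sum of THREE riffle-basic
tensors with `{0, ±1}` coefficients:

* `τ₁`: `A₁ = e₀`, `A₂(·;0) = e₀`, `A₂(·;1) = e₁`, `g = (g(00),g(01),g(10),g(11)) = (1,0,0,-1)`;
* `τ₂`: `A₁ = e₁`, `A₂(·;0) = -e₁`, `A₂(·;1) = e₀`, `g = (0,1,1,0)`;
* `τ₃`: `A₁ = e₀+e₁`, `A₂(·;0) = e₁`, `A₂(·;1) = e₁`, `g = (0,1,0,1)`.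

Hence `riffleRank R (idPow R 2 2) ≤ 3 < 4 = (rank I₂)²` for EVERY commutative ring `R`
(`riffleRank_idPow_two_two_le_three`), answering Rossman's Question 4.1 (multiplicativity under tensor
products of matrices) in the negative at the smallest case, under this reading of the definition.
By the sub-multiplicativity of riffle rank under `⊗` (Rossman, Lemma 3.2) and under the Kronecker
product in the `n`-direction (same one-line closure), this gives `R_riffle(I_n^{⊗k}) ≤ n^{(½·log₂3)k}`
for `n` a power of two and `k` even, which contradicts Conjecture 1.2 (`n^{k-o(log k)}`) and the typed
`RiffleIdentityBound`; those closure lemmas and `¬ RiffleIdentityBound` are NOT proved in this file —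
it records only the kernel-checked seed fact.  Nothing here bears on `VP ≠ VNP`.

References: [Rossman2025] B. Rossman, Riffle Rank, Procedia Comput. Sci. (LAGOS 2025),
doi:10.1016/j.procs.2025.10.301, Def. 3.1, Lemma 3.2, Lemma 3.3, Question 4.1, Conj. 1.2.
-/

-- layout Summits/ValiantsHypothesis/ValiantsHypothesis forces the duplicated namespace component
set_option linter.dupNamespace false

namespace Summit.ValiantsHypothesis.ValiantsHypothesis.Theorems.DepthWindow.Riffle.Negative

open Summit.ValiantsHypothesis.ValiantsHypothesis.Theorems.DepthWindow.Riffle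

universe u

/-- The indicator of `0` on `Fin 2`, integer-valued. -/
def e0 (x : Fin 2) : ℤ := if x = 0 then 1 else 0

/-- The indicator of `1` on `Fin 2`, integer-valued. -/
def e1 (x : Fin 2) : ℤ := if x = 1 then 1 else 0

/-- First factors `A₁^{(l)}(a₁)` of the three witness terms. -/
def A1 : Fin 3 → Fin 2 → ℤ
  | 0 => e0
  | 1 => e1
  | 2 => fun _ => 1

/-- Second factors `A₂^{(l)}(a₂ ; b₁)` of the three witness terms. -/
def A2 : Fin 3 → Fin 2 → Fin 2 → ℤ
  | 0 => fun a b1 => if b1 = 0 then e0 a else e1 a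
  | 1 => fun a b1 => if b1 = 0 then - e1 a else e0 a
  | 2 => fun a _ => e1 a

/-- Coefficient tensors `g^{(l)}(b₁, b₂)` of the three witness terms. -/
def g : Fin 3 → (Fin 2 → Fin 2) → ℤ
  | 0 => fun b => if b 0 = 0 ∧ b 1 = 0 then 1 else if b 0 = 1 ∧ b 1 = 1 then -1 else 0
  | 1 => fun b => if b 0 ≠ b 1 then 1 else 0
  | 2 => fun b => if b 1 = 1 then 1 else 0

/-- The three witness terms as integer tensors `[2]² × [2]² → ℤ`. -/
def term (l : Fin 3) : Tensor2 2 2 ℤ := fun a b => g l b * (A1 l (a 0) * A2 l (a 1) (b 0))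

/-- The factor family of term `l` in the format of `IsRiffleBasic`: factor `i` sees `aᵢ` and the
`b`-prefix of length `i`. -/
def Afam (l : Fin 3) : (i : Fin 2) → Fin 2 → (Fin i → Fin 2) → ℤ
  | ⟨0, _⟩ => fun x _ => A1 l x
  | ⟨1, _⟩ => fun x bp => A2 l x (bp ⟨0, Nat.zero_lt_one⟩)

/-- Each witness term is riffle-basic over `ℤ`. [critic witness] -/
theorem term_isRiffleBasic (l : Fin 3) : IsRiffleBasic ℤ (term l) := by
  refine ⟨g l, Afam l, fun a b => ?_⟩
  simp only [term, Afam, Fin.prod_univ_two]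
  rfl

/-- The three terms sum to the identity tensor `I₂ ⊗ I₂` (all 16 × 16 index pairs, by computation).
[critic witness] -/
theorem idPow_two_two_eq_sum : ∀ a b, idPow ℤ 2 2 a b = ∑ l : Fin 3, term l a b := by
  decide

/-- `R_riffle(I₂ ⊗ I₂) ≤ 3` over `ℤ` for the typed definition. [critic witness] -/
theorem riffleRank_int_idPow_two_two_le_three : riffleRank ℤ (idPow ℤ 2 2) ≤ 3 :=
  Nat.sInf_le ⟨term, term_isRiffleBasic, idPow_two_two_eq_sum⟩

variable (R : Type u) [CommRing R]

/-- The witness terms transported to a commutative ring `R` along `ℤ → R`. -/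
def termR (l : Fin 3) : Tensor2 2 2 R := fun a b => ((term l a b : ℤ) : R)

/-- The transported terms are riffle-basic over `R`. [critic witness] -/
theorem termR_isRiffleBasic (l : Fin 3) : IsRiffleBasic R (termR R l) := by
  refine ⟨fun b => ((g l b : ℤ) : R), fun i x bp => ((Afam l i x bp : ℤ) : R), fun a b => ?_⟩
  simp only [termR, term, Afam, Fin.prod_univ_two, Int.cast_mul]
  rfl

/-- `idPow R` is the cast of `idPow ℤ`. [folklore] -/
theorem idPow_eq_cast (a b : Fin 2 → Fin 2) : idPow R 2 2 a b = ((idPow ℤ 2 2 a b : ℤ) : R) := by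
  unfold idPow
  split_ifs <;> simp

/-- The transported terms sum to `I₂ ⊗ I₂` over `R`. [critic witness] -/
theorem idPow_two_two_eq_sumR : ∀ a b, idPow R 2 2 a b = ∑ l : Fin 3, termR R l a b := by
  intro a b
  rw [idPow_eq_cast, idPow_two_two_eq_sum a b]
  simp [termR, Int.cast_sum]

/-- **`R_riffle(I₂ ⊗ I₂) ≤ 3` over every commutative ring** (in particular over `ℂ`, the field of
`RiffleIdentityBound`): riffle rank, as typed, is not multiplicative under tensor products of matrices.
[critic witness; cite: Rossman2025, Question 4.1] -/
theorem riffleRank_idPow_two_two_le_three : riffleRank R (idPow R 2 2) ≤ 3 :=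
  Nat.sInf_le ⟨termR R, termR_isRiffleBasic R, idPow_two_two_eq_sumR R⟩

end Summit.ValiantsHypothesis.ValiantsHypothesis.Theorems.DepthWindow.Riffle.Negative
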